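import Mathlib
import Summits.MatrixMultiplication.MatrixMultiplication.Theses.HiddenToeplitzCorners
import Summits.MatrixMultiplication.MatrixMultiplication.Theorems.HiddenToeplitzCornersToeplitzLikeDetCostConversionAux
import Literature.Computability.AlgebraicComplexity.ArithCircuitProofs
import Literature.Computability.AlgebraicComplexity.MatMulTotalComplexityProofs
import Literature.Computability.AlgebraicComplexity.FastFourierTransform
import Literature.Computability.AlgebraicComplexity.DivisionSLP
import Literature.LinearAlgebra.Matrix.CauchyDeterminant
import Literature.LinearAlgebra.Matrix.CauchyLike

/-!
# Stub `stub_pencilPad1` of crux `HiddenToeplitzCorners.ToeplitzLikeDetCost` (stmt-MatrixMultiplication-7491),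
# line `Sketch`

Generic algebra of the lower shift `Z` over a commutative ring: the Stein operator
`A ↦ A - Z A Zᵀ` is injective (`Z` is nilpotent), and the identity-first padding `I ⊕ T` of a
Stein-displaced matrix `T - Z T Zᵀ = G Hᵀ` has the free Stein generator
`([δ₀ | δ_{n-N} | 0 ⊕ G], [δ₀ | -δ_{n-N} | 0 ⊕ H])` and the same determinant.

Target tree file: `Summits/MatrixMultiplication/MatrixMultiplication/Theorems/HiddenToeplitzCornersToeplitzLikeDetCostPencilPad1.lean`
(helper for the crux, landed with `--supports stmt-MatrixMultiplication-7491`). The theorem `stub_pencilPad1`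
below must keep EXACTLY this name and signature (it is registered on the crux).
-/

set_option linter.dupNamespace false

namespace Summit.MatrixMultiplication.MatrixMultiplication.Theorems

open scoped BigOperators Matrix
open Literature.Computability.AlgebraicComplexity Literature.LinearAlgebra.Matrix
open Literature.Computability.AlgebraicComplexity.ArithCircuit (FanInTwoSeq freeInputs)
open Summit.MatrixMultiplication.MatrixMultiplication.Theses.HiddenToeplitzCorners (ToeplitzLikeDetCost)

noncomputable section

section PadAlgebra

variable {S : Type*} [CommRing S]

/-- `(Z M) i j = M (i-1) j` (and `0` in row `0`) for the lower shift `Z` over a commutative ring.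
[folklore] -/
theorem pad_shift_mul_apply {n : ℕ} {m : Type*} (M : Matrix (Fin n) m S) (i : Fin n) (j : m) :
    ((Matrix.of fun i j : Fin n => if (i : ℕ) = (j : ℕ) + 1 then (1 : S) else 0) * M) i j =
      if h : 1 ≤ (i : ℕ) then M ⟨(i : ℕ) - 1, by omega⟩ j else 0 := by
  simp only [Matrix.mul_apply, Matrix.of_apply, ite_mul, one_mul, zero_mul]
  exact conv_sum_ite_eq_val_succ i _

/-- `(M Zᵀ) i j = M i (j-1)` (and `0` in column `0`) for the lower shift `Z` over a commutative
ring. [folklore] -/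
theorem pad_mul_shiftT_apply {n : ℕ} {m : Type*} (M : Matrix m (Fin n) S) (i : m) (j : Fin n) :
    (M * (Matrix.of fun i j : Fin n => if (i : ℕ) = (j : ℕ) + 1 then (1 : S) else 0)ᵀ) i j =
      if h : 1 ≤ (j : ℕ) then M i ⟨(j : ℕ) - 1, by omega⟩ else 0 := by
  simp only [Matrix.mul_apply, Matrix.transpose_apply, Matrix.of_apply, mul_ite, mul_one, mul_zero]
  exact conv_sum_ite_eq_val_succ j _

/-- `(Z M Zᵀ) i j = M (i-1) (j-1)` for `i, j ≥ 1`, and `0` in row and column `0`. [folklore] -/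
theorem pad_shift_conj_apply {n : ℕ} (M : Matrix (Fin n) (Fin n) S) (i j : Fin n) :
    ((Matrix.of fun i j : Fin n => if (i : ℕ) = (j : ℕ) + 1 then (1 : S) else 0) * M *
        (Matrix.of fun i j : Fin n => if (i : ℕ) = (j : ℕ) + 1 then (1 : S) else 0)ᵀ) i j =
      if h : 1 ≤ (i : ℕ) ∧ 1 ≤ (j : ℕ) then
        M ⟨(i : ℕ) - 1, by omega⟩ ⟨(j : ℕ) - 1, by omega⟩ else 0 := by
  rw [pad_mul_shiftT_apply]
  by_cases hi : 1 ≤ (i : ℕ) <;> by_cases hj : 1 ≤ (j : ℕ) <;> simp [hi, hj, pad_shift_mul_apply]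

/-- **Injectivity of the Stein operator** `A ↦ A - Z A Zᵀ` of the (nilpotent) lower shift `Z`:
row `i` of `A = Z A Zᵀ` vanishes by induction on `i`. [folklore] -/
theorem pad_stein_injective {N : ℕ} (A : Matrix (Fin N) (Fin N) S)
    (h : A - (Matrix.of fun i j : Fin N => if (i : ℕ) = (j : ℕ) + 1 then (1 : S) else 0) * A *
      (Matrix.of fun i j : Fin N => if (i : ℕ) = (j : ℕ) + 1 then (1 : S) else 0)ᵀ = 0) :
    A = 0 := by
  rw [sub_eq_zero] at h
  have hA : ∀ i j : Fin N, A i j = _ := fun i j => congrFun (congrFun h i) j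
  have key : ∀ k : ℕ, ∀ i j : Fin N, (i : ℕ) = k → A i j = 0 := by
    intro k
    induction k with
    | zero =>
      intro i j hi
      rw [hA, pad_shift_conj_apply, dif_neg (by omega)]
    | succ k ih =>
      intro i j hi
      rw [hA, pad_shift_conj_apply]
      split_ifs with hij
      · exact ih _ _ (by dsimp only; omega)
      · rfl
  ext i j
  exact key i i j rfl

/-- The reindexing `Fin n → Fin (n-N) ⊕ Fin N` on the first block. [folklore] -/
theorem pad_e_apply_lt {N n : ℕ} (hNn : N ≤ n) (i : Fin n) (hi : (i : ℕ) < n - N) :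
    (finSumFinEquiv.symm (i.cast (Nat.sub_add_cancel hNn).symm) : Fin (n - N) ⊕ Fin N) =
      Sum.inl ⟨i, hi⟩ := by
  have : i.cast (Nat.sub_add_cancel hNn).symm = Fin.castAdd N ⟨i, hi⟩ := Fin.ext rfl
  rw [this, finSumFinEquiv_symm_apply_castAdd]

/-- The reindexing `Fin n → Fin (n-N) ⊕ Fin N` on the second block. [folklore] -/
theorem pad_e_apply_ge {N n : ℕ} (hNn : N ≤ n) (i : Fin n) (hi : n - N ≤ (i : ℕ)) :
    (finSumFinEquiv.symm (i.cast (Nat.sub_add_cancel hNn).symm) : Fin (n - N) ⊕ Fin N) =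
      Sum.inr ⟨i - (n - N), by omega⟩ := by
  have : i.cast (Nat.sub_add_cancel hNn).symm = Fin.natAdd (n - N) ⟨i - (n - N), by omega⟩ :=
    Fin.ext (by simp only [Fin.val_cast, Fin.val_natAdd]; omega)
  rw [this, finSumFinEquiv_symm_apply_natAdd]

/-- Entries of the identity-first padding `I ⊕ T` pulled back to `Fin n`. [folklore] -/
theorem pad_T_apply {N n : ℕ} (hNn : N ≤ n) (T : Matrix (Fin N) (Fin N) S) (i j : Fin n) :
    ((Matrix.fromBlocks (1 : Matrix (Fin (n - N)) (Fin (n - N)) S) 0 0 T).submatrix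
        (fun i : Fin n => finSumFinEquiv.symm (i.cast (Nat.sub_add_cancel hNn).symm))
        (fun i : Fin n => finSumFinEquiv.symm (i.cast (Nat.sub_add_cancel hNn).symm))) i j =
      if hi : (i : ℕ) < n - N then (if (i : ℕ) = (j : ℕ) then 1 else 0)
      else if hj : (j : ℕ) < n - N then 0
      else T ⟨(i : ℕ) - (n - N), by omega⟩ ⟨(j : ℕ) - (n - N), by omega⟩ := by
  rw [Matrix.submatrix_apply]
  by_cases hi : (i : ℕ) < n - N
  · rw [pad_e_apply_lt hNn i hi, dif_pos hi]
    by_cases hj : (j : ℕ) < n - N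
    · rw [pad_e_apply_lt hNn j hj, Matrix.fromBlocks_apply₁₁, Matrix.one_apply]
      simp only [Fin.mk.injEq]
    · rw [pad_e_apply_ge hNn j (not_lt.mp hj), Matrix.fromBlocks_apply₁₂, Matrix.zero_apply,
        if_neg (by omega)]
  · rw [pad_e_apply_ge hNn i (not_lt.mp hi), dif_neg hi]
    by_cases hj : (j : ℕ) < n - N
    · rw [pad_e_apply_lt hNn j hj, Matrix.fromBlocks_apply₂₁, Matrix.zero_apply, dif_pos hj]
    · rw [pad_e_apply_ge hNn j (not_lt.mp hj), Matrix.fromBlocks_apply₂₂, dif_neg hj]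

/-- Entries of a generator padded by a zero block on top, pulled back to `Fin n`. [folklore] -/
theorem pad_G_apply {N n : ℕ} (hNn : N ≤ n) {q : Type*} (G : Matrix (Fin N) q S) (i : Fin n)
    (k : q) :
    ((Matrix.fromRows (0 : Matrix (Fin (n - N)) q S) G).submatrix
        (fun i : Fin n => finSumFinEquiv.symm (i.cast (Nat.sub_add_cancel hNn).symm)) id) i k =
      if hi : (i : ℕ) < n - N then 0 else G ⟨(i : ℕ) - (n - N), by omega⟩ k := by
  rw [Matrix.submatrix_apply, id]
  by_cases hi : (i : ℕ) < n - N
  · rw [pad_e_apply_lt hNn i hi, Matrix.fromRows_apply_inl, Matrix.zero_apply, dif_pos hi]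
  · rw [pad_e_apply_ge hNn i (not_lt.mp hi), Matrix.fromRows_apply_inr, dif_neg hi]

/-- The determinant of the identity-first padding `I ⊕ T` is `det T`. [folklore] -/
theorem pad_det {N n : ℕ} (hNn : N ≤ n) (T : Matrix (Fin N) (Fin N) S) :
    ((Matrix.fromBlocks (1 : Matrix (Fin (n - N)) (Fin (n - N)) S) 0 0 T).submatrix
        (fun i : Fin n => finSumFinEquiv.symm (i.cast (Nat.sub_add_cancel hNn).symm))
        (fun i : Fin n => finSumFinEquiv.symm (i.cast (Nat.sub_add_cancel hNn).symm))).det =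
      T.det := by
  have he : (fun i : Fin n =>
      (finSumFinEquiv.symm (i.cast (Nat.sub_add_cancel hNn).symm) : Fin (n - N) ⊕ Fin N)) =
      ⇑((finCongr (Nat.sub_add_cancel hNn).symm).trans finSumFinEquiv.symm) := by
    funext i
    simp
  rw [he, Matrix.det_submatrix_equiv_self, Matrix.det_fromBlocks_zero₂₁, Matrix.det_one, one_mul]

/-- **Identity-first padding of a Stein-displaced matrix**: if `T - Z_N T Z_Nᵀ = G Hᵀ` then the
padding `I_{n-N} ⊕ T` (identity block first) satisfies
`T'' - Z_n T'' Z_nᵀ = [δ₀ | δ_{n-N} | 0 ⊕ G] [δ₀ | -δ_{n-N} | 0 ⊕ H]ᵀ`; proved entrywise by cases on the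
two blocks (the case `n = N`, where both basis columns coincide and cancel, included). [folklore] -/
theorem pad_stein_display {N n : ℕ} (hNn : N ≤ n) {q : Type*} [Fintype q]
    (T : Matrix (Fin N) (Fin N) S) (Gs Hs : Matrix (Fin N) q S)
    (hT : T - (Matrix.of fun i j : Fin N => if (i : ℕ) = (j : ℕ) + 1 then (1 : S) else 0) * T *
      (Matrix.of fun i j : Fin N => if (i : ℕ) = (j : ℕ) + 1 then (1 : S) else 0)ᵀ = Gs * Hsᵀ) :
    ((Matrix.fromBlocks (1 : Matrix (Fin (n - N)) (Fin (n - N)) S) 0 0 T).submatrix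
        (fun i : Fin n => finSumFinEquiv.symm (i.cast (Nat.sub_add_cancel hNn).symm))
        (fun i : Fin n => finSumFinEquiv.symm (i.cast (Nat.sub_add_cancel hNn).symm))) -
      (Matrix.of fun i j : Fin n => if (i : ℕ) = (j : ℕ) + 1 then (1 : S) else 0) *
      ((Matrix.fromBlocks (1 : Matrix (Fin (n - N)) (Fin (n - N)) S) 0 0 T).submatrix
        (fun i : Fin n => finSumFinEquiv.symm (i.cast (Nat.sub_add_cancel hNn).symm))
        (fun i : Fin n => finSumFinEquiv.symm (i.cast (Nat.sub_add_cancel hNn).symm))) *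
      (Matrix.of fun i j : Fin n => if (i : ℕ) = (j : ℕ) + 1 then (1 : S) else 0)ᵀ =
    (Matrix.fromCols (Matrix.fromCols
        (Matrix.of fun (i : Fin n) (_ : Fin 1) => if (i : ℕ) = 0 then (1 : S) else 0)
        (Matrix.of fun (i : Fin n) (_ : Fin 1) => if (i : ℕ) = n - N then (1 : S) else 0))
      ((Matrix.fromRows (0 : Matrix (Fin (n - N)) q S) Gs).submatrix
        (fun i : Fin n => finSumFinEquiv.symm (i.cast (Nat.sub_add_cancel hNn).symm)) id)) *
    (Matrix.fromCols (Matrix.fromCols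
        (Matrix.of fun (i : Fin n) (_ : Fin 1) => if (i : ℕ) = 0 then (1 : S) else 0)
        (Matrix.of fun (i : Fin n) (_ : Fin 1) => if (i : ℕ) = n - N then (-1 : S) else 0))
      ((Matrix.fromRows (0 : Matrix (Fin (n - N)) q S) Hs).submatrix
        (fun i : Fin n => finSumFinEquiv.symm (i.cast (Nat.sub_add_cancel hNn).symm)) id))ᵀ := by
  -- the Stein equation for `T`, entrywise and solved for the generator product
  have hGH : ∀ a b : Fin N, ∑ k, Gs a k * Hs b k = T a b -
      (if h : 1 ≤ (a : ℕ) ∧ 1 ≤ (b : ℕ) then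
        T ⟨(a : ℕ) - 1, by omega⟩ ⟨(b : ℕ) - 1, by omega⟩ else 0) := by
    intro a b
    have h := congrFun (congrFun hT a) b
    rw [Matrix.sub_apply, pad_shift_conj_apply, Matrix.mul_apply] at h
    simp only [Matrix.transpose_apply] at h
    exact h.symm
  ext i j
  rw [Matrix.sub_apply, pad_shift_conj_apply, Matrix.transpose_fromCols, Matrix.fromCols_mul_fromRows,
    Matrix.transpose_fromCols, Matrix.fromCols_mul_fromRows, Matrix.add_apply, Matrix.add_apply]
  simp only [Matrix.mul_apply, Fintype.sum_unique, Matrix.transpose_apply, Matrix.of_apply,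
    pad_T_apply hNn, pad_G_apply hNn]
  by_cases hi : (i : ℕ) < n - N
  · -- first block row: the padded generator vanishes, only `δ₀ δ₀ᵀ` contributes
    simp only [hi, Nat.ne_of_lt hi, dif_pos, if_false, zero_mul, Finset.sum_const_zero, add_zero]
    split_ifs <;> first | (exfalso; omega) | ring1
  · by_cases hj : (j : ℕ) < n - N
    · -- second block row, first block column: everything vanishes
      simp only [hi, hj, Nat.ne_of_lt hj, dif_pos, dif_neg, not_false_eq_true, if_false, mul_zero,
        Finset.sum_const_zero, add_zero]
      split_ifs <;> first | (exfalso; omega) | ring1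
    · -- second block: the Stein equation of `T`, corrected at the corner `(n-N, n-N)`
      simp only [hi, hj, dif_neg, not_false_eq_true]
      have e1 : ∀ (x : ℕ) (h1 : x - 1 - (n - N) < N),
          (⟨x - 1 - (n - N), h1⟩ : Fin N) = ⟨x - (n - N) - 1, by omega⟩ := fun x h1 => by
        simp only [Fin.mk.injEq]; omega
      rw [hGH]
      simp only [e1]
      split_ifs <;> first | (exfalso; omega) | ring1

end PadAlgebra

/-- **Stub `pencilPad1`** — see `Lines/Sketch.lean`: (P1) the Stein operator of the nilpotent lower
shift is injective; (P2) identity-first padding of a Stein-displaced matrix has a free generator of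
length `β + 2` and the same determinant. [folklore] -/
theorem stub_pencilPad1 :
    (∀ (S : Type) [CommRing S] (N : ℕ) (A : Matrix (Fin N) (Fin N) S),
        A - (Matrix.of fun i j : Fin N => if (i : ℕ) = (j : ℕ) + 1 then (1 : S) else 0) * A *
          (Matrix.of fun i j : Fin N => if (i : ℕ) = (j : ℕ) + 1 then (1 : S) else 0)ᵀ = 0 → A = 0) ∧
    (∀ (S : Type) [CommRing S] (N n : ℕ) (hNn : N ≤ n) (q : Type) [Fintype q]
        (T : Matrix (Fin N) (Fin N) S) (Gs Hs : Matrix (Fin N) q S), 0 < N →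
        T - (Matrix.of fun i j : Fin N => if (i : ℕ) = (j : ℕ) + 1 then (1 : S) else 0) * T *
          (Matrix.of fun i j : Fin N => if (i : ℕ) = (j : ℕ) + 1 then (1 : S) else 0)ᵀ = Gs * Hsᵀ →
        ((Matrix.fromBlocks (1 : Matrix (Fin (n - N)) (Fin (n - N)) S) 0 0 T).submatrix (fun i : Fin n => finSumFinEquiv.symm (i.cast (Nat.sub_add_cancel hNn).symm)) (fun i : Fin n => finSumFinEquiv.symm (i.cast (Nat.sub_add_cancel hNn).symm))) -
          (Matrix.of fun i j : Fin n => if (i : ℕ) = (j : ℕ) + 1 then (1 : S) else 0) *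
          ((Matrix.fromBlocks (1 : Matrix (Fin (n - N)) (Fin (n - N)) S) 0 0 T).submatrix (fun i : Fin n => finSumFinEquiv.symm (i.cast (Nat.sub_add_cancel hNn).symm)) (fun i : Fin n => finSumFinEquiv.symm (i.cast (Nat.sub_add_cancel hNn).symm))) *
          (Matrix.of fun i j : Fin n => if (i : ℕ) = (j : ℕ) + 1 then (1 : S) else 0)ᵀ =
          (Matrix.fromCols (Matrix.fromCols (Matrix.of fun (i : Fin n) (_ : Fin 1) => if (i : ℕ) = 0 then (1 : S) else 0)
            (Matrix.of fun (i : Fin n) (_ : Fin 1) => if (i : ℕ) = n - N then (1 : S) else 0))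
          ((Matrix.fromRows (0 : Matrix (Fin (n - N)) q S) Gs).submatrix (fun i : Fin n => finSumFinEquiv.symm (i.cast (Nat.sub_add_cancel hNn).symm)) id)) *
          (Matrix.fromCols (Matrix.fromCols (Matrix.of fun (i : Fin n) (_ : Fin 1) => if (i : ℕ) = 0 then (1 : S) else 0)
            (Matrix.of fun (i : Fin n) (_ : Fin 1) => if (i : ℕ) = n - N then (-1 : S) else 0))
          ((Matrix.fromRows (0 : Matrix (Fin (n - N)) q S) Hs).submatrix (fun i : Fin n => finSumFinEquiv.symm (i.cast (Nat.sub_add_cancel hNn).symm)) id))ᵀ ∧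
        (((Matrix.fromBlocks (1 : Matrix (Fin (n - N)) (Fin (n - N)) S) 0 0 T).submatrix (fun i : Fin n => finSumFinEquiv.symm (i.cast (Nat.sub_add_cancel hNn).symm)) (fun i : Fin n => finSumFinEquiv.symm (i.cast (Nat.sub_add_cancel hNn).symm)))).det = T.det) :=
  ⟨fun _ _ _ A h => pad_stein_injective A h,
    fun _ _ _ _ hNn _ _ T Gs Hs _ hT => ⟨pad_stein_display hNn T Gs Hs hT, pad_det hNn T⟩⟩

end

end Summit.MatrixMultiplication.MatrixMultiplication.Theorems
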